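import Summits.HodgeConjecture.HodgeConjecture.Theorems.R90S4SimilConjEquivalence   -- ★ (this seat) `isU2SimilConj_equivalence`: similitude conjugacy is an equivalence relation
import Literature.NumberTheory.Automorphic.IrreducibleClassesBoxCharRigidity          -- ★ `IrrClass.boxChar`, `boxChar_injective`, `boxChar_eq_boxChar_iff` (joint rigidity)
import Literature.NumberTheory.Automorphic.HeckeEigencharacterPackage              -- ★ `IrrClass.IsAdmissible` (the generator's admissibility, as file B spells it)
import HarnessLib

/-!
# R90-TF · S4 (Ch. 13.1–2) · socket S4#B2 `stub_R90_S4_H_disjoint` — DISTINCT `H_v`-PACKETS ARE DISJOINT, proved (BY NAME-SHAPE, Lines-free)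

Cell `hodgecm-mathlib`, crux H413 (`stmt-HodgeConjecture-24833`), route of record `HCCMUnconditional`; programme R90-TF (brief
`director/R90-BRIEF.v2.md`), section S4 = Rogawski Ch. 13.1–2, seat `R90-C131-p02 (g0)`, DEAL-S4-WAVE1 (K2E2-plan g6) hand p02 = socket
S4#B2 of `Cruxes/H413/Lines/R90_S4_HPacketsU2B.lean` (:327):

  `stub_R90_S4_H_disjoint : ∀ L … v (S S′ : Finset (IrrClass (HLoc L v))), IsRogPacketH L v S → IsRogPacketH L v S′ → (S ∩ S′).Nonempty → S = S′`.

PROOF lane, theorems only (no `def`, no instance, no notation, no `sorry`); `--supports stmt-HodgeConjecture-24833 --as helper`.  A `Theorems/`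
file cannot import `Cruxes/…/Lines/…` (CONVENTIONS §2), so the theorem below states the socket BY NAME-SHAPE: its TYPE is the socket's type
with the line's §1 definitions `HLoc = U2Loc × U1Loc`, `IsRogPacketH`, `IsRogPacketU2`, `IsU2SimilConj`, `Φ₂Loc` replaced by their BODIES
token for token (so that, in a file importing both, `example : <type of stub_R90_S4_H_disjoint> := isRogPacketH_disjoint` elaborates by
`δ`-unfolding alone — the by-import identity probe of the hand's REPORT-FIRST line).

THE MATHEMATICS [Rogawski1990, §11.1 p. 161 «An L-packet on `G` [= `U(2)`] is, by definition, a `PGL₂(F)`-orbit in `E(G)`»; §12.1 pp. 171–172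
«If `ρ = ρ₁ ⊗ χ`, where `ρ₁` is a representation of `U(2)` and `χ` is a character of `U(1)` …»].  An `H_v`-packet is `S = O ⊠ χ`
(★ `IrrClass.boxChar χ hχ`, injective) for a `U(Φ₂)`-packet `O` = the full similitude-conjugacy orbit `{c ∣ σ ~ c}` of an admissible class
`σ` and a smooth character `χ` of `U(Φ₁)_v`.  If `S = O ⊠ χ` and `S′ = O′ ⊠ χ′` share a member `c ⊠ χ = c′ ⊠ χ′` (`c ∈ O`, `c′ ∈ O′`), then
JOINT RIGIDITY ★ `boxChar_eq_boxChar_iff` ([BushnellHenniart2006, §9.1]: restrict an isomorphism `r ⊠ χ ≅ r′ ⊠ χ′` to `1 × U(Φ₁)` and to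
`U(Φ₂) × 1`) gives `χ = χ′` AND `c = c′`; so the orbits `O ∋ c` and `O′ ∋ c` of the generators `σ ~ c`, `σ′ ~ c` meet, and since
similitude conjugacy is an EQUIVALENCE RELATION (★ `isU2SimilConj_equivalence`, F1 of this road: `T = 1`, `T⁻¹`, `T T′`) they coincide
memberwise (`σ ~ x ↔ σ′ ~ x`), hence as finsets (`Finset.ext`); finally `S = O ⊠ χ = O ⊠ χ′ = S′` (the two openness witnesses `hχ, hχ′`
are proofs of one proposition).  The admissibility of the generators is not used.

CONTENTS: one theorem, **`isRogPacketH_disjoint`** = the socket S4#B2 by name-shape.  HONEST LABEL: this proves the S4#B2 socket's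
statement (a helper of file B; the socket itself is re-pointed by the section's pen, not here); REL ≠ ★ ≠ BUILT; HC_CM is proved only
modulo the 7 printed citations (2 remaining named inputs: hLiu418 = stmt-HodgeConjecture-24832, h413 = stmt-HodgeConjecture-24833) until
rung 0 closes.

## References
* [Rogawski1990] J. D. Rogawski, *Automorphic Representations of Unitary Groups in Three Variables*, Ann. of Math. Stud. 123 (1990), §11.1 p. 161,
  Prop. 11.1.1; §12.1 pp. 171–172.
* [BushnellHenniart2006] C. J. Bushnell, G. Henniart, *The Local Langlands Conjecture for GL(2)*, Grundlehren 335 (2006), §1.1, §9.1.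
* [PlatonovRapinchuk1994] V. Platonov, A. Rapinchuk, *Algebraic Groups and Number Theory* (1994), §2.3.
-/

set_option autoImplicit false
-- the mandated namespace repeats the single-problem summit's segment (`HodgeConjecture.HodgeConjecture`)
set_option linter.dupNamespace false

noncomputable section

open NumberField IsDedekindDomain
open scoped Matrix MatrixGroups Classical   -- `Classical` exactly as file B: the `∩` of the socket is `Finset.instInter` at `Classical.propDecidable`
open Literature.NumberTheory.Automorphic Literature.NumberTheory.Automorphic.UnitaryGroup

namespace Summit.HodgeConjecture.HodgeConjecture.R90.S4

/-- **Socket S4#B2 (KD2) — distinct `H_v`-packets are disjoint, PROVED** (name-shape of `stub_R90_S4_H_disjoint`, file B :327): for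
`H_v = U(Φ₂)(L⁺_v) × U(Φ₁)(L⁺_v)`, two packets `S = O ⊠ χ`, `S′ = O′ ⊠ χ′` (`O, O′` full similitude orbits of admissible classes, `χ, χ′`
smooth characters of `U(Φ₁)_v`) with a common member are EQUAL: `c ⊠ χ = c′ ⊠ χ′ ⇒ χ = χ′ ∧ c = c′` (★ `IrrClass.boxChar_eq_boxChar_iff`,
joint rigidity), the orbits of `σ ∼ c` and `σ′ ∼ c` coincide because similitude conjugacy is an equivalence relation
(★ `isU2SimilConj_equivalence`), and `O ⊠ χ = O ⊠ χ′` once `χ = χ′`. [cite: Rogawski1990, §11.1 p. 161; §12.1 p. 171]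
[cite: BushnellHenniart2006, §9.1] -/
theorem isRogPacketH_disjoint (L : Type) [Field L] [NumberField L] [IsCMField L] (v : HeightOneSpectrum (𝓞 ↥(maximalRealSubfield L)))
    (S S' : Finset (IrrClass
      ((cmDatum L 2 (Matrix.of fun i j : Fin 2 => if i.val + j.val + 1 = 2 then (1 : L) else 0)).Local v ×
        (cmDatum L 1 (Matrix.of fun i j : Fin 1 => if i.val + j.val + 1 = 1 then (1 : L) else 0)).Local v))) :
    (∃ (O : Finset (IrrClass ((cmDatum L 2 (Matrix.of fun i j : Fin 2 => if i.val + j.val + 1 = 2 then (1 : L) else 0)).Local v)))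
        (χ : (cmDatum L 1 (Matrix.of fun i j : Fin 1 => if i.val + j.val + 1 = 1 then (1 : L) else 0)).Local v →* ℂˣ)
        (hχ : IsOpen ((χ.ker : Subgroup ((cmDatum L 1 (Matrix.of fun i j : Fin 1 => if i.val + j.val + 1 = 1 then (1 : L) else 0)).Local v)) :
          Set ((cmDatum L 1 (Matrix.of fun i j : Fin 1 => if i.val + j.val + 1 = 1 then (1 : L) else 0)).Local v))),
        (∃ σ : IrrClass ((cmDatum L 2 (Matrix.of fun i j : Fin 2 => if i.val + j.val + 1 = 2 then (1 : L) else 0)).Local v),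
          σ.IsAdmissible ∧ ∀ c, c ∈ O ↔
            ∃ (T : GL (Fin 2) (LocalRing L v)) (a : LocalRing L v) (ha : IsUnit a)
              (h : formCongr (conjLocal L (IsCMField.complexConj L) v) T
                  ((Matrix.of fun i j : Fin 2 => if i.val + j.val + 1 = 2 then (1 : L) else 0).map (algebraMap L (LocalRing L v))) =
                a • (Matrix.of fun i j : Fin 2 => if i.val + j.val + 1 = 2 then (1 : L) else 0).map (algebraMap L (LocalRing L v))),
              c = IrrClass.comap (cmDatumLocalCongr L v T ha h) σ) ∧
        S = O.map ⟨IrrClass.boxChar χ hχ, IrrClass.boxChar_injective χ hχ⟩) →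
    (∃ (O : Finset (IrrClass ((cmDatum L 2 (Matrix.of fun i j : Fin 2 => if i.val + j.val + 1 = 2 then (1 : L) else 0)).Local v)))
        (χ : (cmDatum L 1 (Matrix.of fun i j : Fin 1 => if i.val + j.val + 1 = 1 then (1 : L) else 0)).Local v →* ℂˣ)
        (hχ : IsOpen ((χ.ker : Subgroup ((cmDatum L 1 (Matrix.of fun i j : Fin 1 => if i.val + j.val + 1 = 1 then (1 : L) else 0)).Local v)) :
          Set ((cmDatum L 1 (Matrix.of fun i j : Fin 1 => if i.val + j.val + 1 = 1 then (1 : L) else 0)).Local v))),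
        (∃ σ : IrrClass ((cmDatum L 2 (Matrix.of fun i j : Fin 2 => if i.val + j.val + 1 = 2 then (1 : L) else 0)).Local v),
          σ.IsAdmissible ∧ ∀ c, c ∈ O ↔
            ∃ (T : GL (Fin 2) (LocalRing L v)) (a : LocalRing L v) (ha : IsUnit a)
              (h : formCongr (conjLocal L (IsCMField.complexConj L) v) T
                  ((Matrix.of fun i j : Fin 2 => if i.val + j.val + 1 = 2 then (1 : L) else 0).map (algebraMap L (LocalRing L v))) =
                a • (Matrix.of fun i j : Fin 2 => if i.val + j.val + 1 = 2 then (1 : L) else 0).map (algebraMap L (LocalRing L v))),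
              c = IrrClass.comap (cmDatumLocalCongr L v T ha h) σ) ∧
        S' = O.map ⟨IrrClass.boxChar χ hχ, IrrClass.boxChar_injective χ hχ⟩) →
    (S ∩ S').Nonempty → S = S' := by
  rintro ⟨O, χ, hχ, ⟨σ, -, hO⟩, rfl⟩ ⟨O', χ', hχ', ⟨σ', -, hO'⟩, rfl⟩ ⟨τ, hτ⟩
  obtain ⟨hτS, hτS'⟩ := Finset.mem_inter.1 hτ
  obtain ⟨c, hc, rfl⟩ := Finset.mem_map.1 hτS
  obtain ⟨c', hc', hcc'⟩ := Finset.mem_map.1 hτS'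
  -- joint rigidity: the common member `c′ ⊠ χ′ = c ⊠ χ` forces `c′ = c` and `χ′ = χ`
  obtain ⟨hcc, hχχ⟩ := (IrrClass.boxChar_eq_boxChar_iff hχ' hχ).1 hcc'
  subst hχχ
  -- the two similitude orbits meet at `c`, hence coincide (equivalence relation)
  have hE := isU2SimilConj_equivalence L v
  have h1 := (hO c).1 hc
  have h2 := (hO' c).1 (hcc ▸ hc')
  obtain rfl : O = O' := by
    ext x
    rw [hO x, hO' x]
    exact ⟨fun hx => hE.trans (hE.trans h2 (hE.symm h1)) hx, fun hx => hE.trans (hE.trans h1 (hE.symm h2)) hx⟩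
  -- `O ⊠ χ` with either openness witness is the same finset
  rfl

end Summit.HodgeConjecture.HodgeConjecture.R90.S4

end
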